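import Mathlib
import Literature.MathematicalPhysics.StatisticalMechanics.LocalMatchingCompactness

/-!
# Kinematic compactness: approximate local charts integrate approximately

Stub `stub_kinematicCompactness` of line `Sketch` of the crux
`Summit.AtomisticToContinuum.Crystallization.Theses.PricedLinkCensus.StackingHinge`
(item `stmt-AtomisticToContinuum-14993`).

## Statement

Let `S ⊆ ℝ³` be `δ₀`-uniformly discrete with finite local complexity (for every radius `ρ` the
centred patches `(S - z) ∩ B̄(0, ρ)`, `z ∈ S`, form a finite family), `0 < r`, `0 < R`,
`R + r + 3 ≤ R'`. HYPOTHESIS (exact integration): for every `δ₀`-separated window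
`W ⊆ B̄(0, R')` with `0 ∈ W`, if every `w ∈ W` with `‖w‖ ≤ R + 1` has an exact `r`-chart (a rigid
motion `g` with `W ∩ B̄(w, r) = g S ∩ B̄(w, r)`), then there is an exact global `R`-chart at `0`.
CONCLUSION (approximate integration): for every `ε > 0` there is `θ > 0` such that for every such
window, `θ`-approximate `(r+1)`-charts at all `w ∈ W` with `‖w‖ ≤ R + 2` yield an
`ε`-approximate global `R`-chart at `0`.

## Proof

By contradiction and compactness. Bad windows `W_n` at tolerance `1/(n+1)` have, along a
subsequence, a local-matching limit `W` (`exists_subseq_forall_eventually_ballMatch` of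
`Literature/…/LocalMatchingCompactness.lean`), which is `δ₀`-separated, contains `0` and lies in
`B̄(0, R')`. MAIN LEMMA `exact_charts_of_approx`: `W` has EXACT `r`-charts at its points of norm
`≤ R + 1` — approximate charts `g_n` at approximants `w_n → w` are re-based at base points
`z_n ∈ S` (`g_n z_n ≈ w_n`); by finite local complexity the centred patches
`(S - z_n) ∩ B̄(0, r + 2)` are constant along a subsequence (pigeonhole), and the re-based rigid
motions `g_n ∘ (· + z_n)`, which move `0` boundedly, converge pointwise along a further
subsequence to a rigid motion (`exists_subseq_tendsto_affineIsometryEquiv`: bounded sequences in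
the proper space `ℝ³ × (ℝ³ →L[ℝ] ℝ³)`, the pointwise limit is an isometry, hence an affine
isometry by strict convexity, hence an affine isometric equivalence by finite dimension); the
limit motion is an exact chart because `W` is closed (separated) and the patch is finite. The
exact-integration hypothesis then charts `W` globally by some `g`; since `W ∩ B̄(0, R + 1)` is
finite, no point of `W` has norm in `(R, R + η₀]` for some `η₀ > 0`, so for `n` large `g` is an
`ε`-chart of `W_n` — contradiction.

Pure metric geometry: no energies, no lattices beyond finite local complexity.
-/

namespace Summit.AtomisticToContinuum.Crystallization.Theorems.PricedHcpWindowsKinematicCompactness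

open Filter Topology Metric Set
open Literature.MathematicalPhysics.StatisticalMechanics

/-! ## Elementary tools -/

/-- `‖a‖ ≤ dist a b + ‖b‖`. [folklore] -/
theorem norm_le_dist_add_norm {F : Type*} [SeminormedAddCommGroup F] (a b : F) :
    ‖a‖ ≤ dist a b + ‖b‖ := by
  simpa only [dist_zero_right] using dist_triangle a b 0

/-- A point off a finite set is at positive distance from it. [folklore] -/
theorem exists_pos_forall_le_dist {α : Type*} [MetricSpace α] {A : Set α} (hA : A.Finite) {p : α}
    (hp : p ∉ A) : ∃ η : ℝ, 0 < η ∧ ∀ a ∈ A, η ≤ dist a p := by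
  obtain ⟨η, hη, hball⟩ := Metric.isOpen_iff.1 hA.isClosed.isOpen_compl p hp
  exact ⟨η, hη, fun a ha => not_lt.1 fun h => hball (mem_ball.2 h) ha⟩

/-- A separated set is closed: a point approached arbitrarily well by a `δ`-separated set
(`δ > 0`) belongs to it. [folklore] -/
theorem mem_of_forall_exists_dist_lt {d : ℕ} {W : Set (EuclideanSpace ℝ (Fin d))} {δ : ℝ}
    (hδ : 0 < δ) (hsep : ∀ p ∈ W, ∀ q ∈ W, p ≠ q → δ ≤ dist p q) {p : EuclideanSpace ℝ (Fin d)}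
    (hp : ∀ η : ℝ, 0 < η → ∃ s ∈ W, dist s p < η) : p ∈ W := by
  by_contra hpW
  have hfin : (W ∩ closedBall p 1).Finite :=
    finite_of_forall_le_dist_of_subset_closedBall hδ
      (fun a ha b hb hab => hsep a ha.1 b hb.1 hab) inter_subset_right
  obtain ⟨η, hη, hfar⟩ := exists_pos_forall_le_dist hfin (p := p) fun h => hpW h.1
  obtain ⟨s, hs, hsp⟩ := hp (min η 1) (lt_min hη one_pos)
  have := hfar s ⟨hs, mem_closedBall.2 (hsp.le.trans (min_le_right _ _))⟩
  exact absurd (hsp.trans_le (min_le_left _ _)) (not_lt.2 this)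

/-- Pigeonhole: a sequence with values in a finite set takes some value frequently. [folklore] -/
theorem exists_frequently_eq {α : Type*} {F : Set α} (hF : F.Finite) {u : ℕ → α}
    (hu : ∀ n, u n ∈ F) : ∃ T ∈ F, ∃ᶠ n in atTop, u n = T := by
  by_contra h
  push Not at h
  obtain ⟨n, hn⟩ := ((eventually_all_finite hF).2 h).exists
  exact hn (u n) (hu n) rfl

/-- **Compactness of rigid motions with bounded translation part**: a sequence of rigid motions
of a finite-dimensional real inner product space moving the origin boundedly has a pointwise
convergent subsequence whose limit is a rigid motion (bounded sequences in the proper space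
`F × (F →L[ℝ] F)`; the pointwise limit is an isometry, hence affine by strict convexity, hence an
equivalence by finite dimension). [folklore] -/
theorem exists_subseq_tendsto_affineIsometryEquiv {F : Type*} [NormedAddCommGroup F]
    [InnerProductSpace ℝ F] [FiniteDimensional ℝ F] (h : ℕ → F ≃ᵃⁱ[ℝ] F) {C : ℝ}
    (hC : ∀ n, ‖h n 0‖ ≤ C) :
    ∃ (g : F ≃ᵃⁱ[ℝ] F) (ψ : ℕ → ℕ), StrictMono ψ ∧
      ∀ x, Tendsto (fun k => h (ψ k) x) atTop (𝓝 (g x)) := by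
  haveI : Inhabited F := ⟨0⟩
  set u : ℕ → F × (F →L[ℝ] F) :=
    fun n => (h n 0, (h n).linearIsometryEquiv.toLinearIsometry.toContinuousLinearMap) with hu_def
  have hux : ∀ n x, h n x = (u n).2 x + (u n).1 := fun n x => by
    show h n x = (h n).linearIsometryEquiv.toLinearIsometry.toContinuousLinearMap x + h n 0
    simpa using (h n).map_vadd 0 x
  have hu : ∀ n, u n ∈ closedBall (0 : F × (F →L[ℝ] F)) (max C 1) := fun n => by
    rw [mem_closedBall_zero_iff, Prod.norm_def, max_le_iff]
    exact ⟨(hC n).trans (le_max_left _ _),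
      (LinearIsometry.norm_toContinuousLinearMap_le _).trans (le_max_right _ _)⟩
  obtain ⟨p, -, ψ, hψ, hlim⟩ := tendsto_subseq_of_bounded isBounded_closedBall hu
  have hpt : ∀ x, Tendsto (fun k => h (ψ k) x) atTop (𝓝 (p.2 x + p.1)) := by
    intro x
    have h1 : Tendsto (fun k => (u (ψ k)).1) atTop (𝓝 p.1) := (continuous_fst.tendsto _).comp hlim
    have h2 : Tendsto (fun k => (u (ψ k)).2 x) atTop (𝓝 (p.2 x)) :=
      (((ContinuousLinearMap.apply ℝ F x).continuous.comp continuous_snd).tendsto _).comp hlim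
    simp_rw [hux]
    exact h2.add h1
  have hf : Isometry fun x => p.2 x + p.1 :=
    Isometry.of_dist_eq fun x y =>
      tendsto_nhds_unique ((hpt x).dist (hpt y)) (by simp)
  exact ⟨hf.affineIsometryOfStrictConvexSpace.toAffineIsometryEquiv rfl, ψ, hψ, fun x => by
    simpa using hpt x⟩

/-! ## Exact charts of a local-matching limit -/

/-- **Limits of approximately charted sets are exactly charted.** Let `S ⊆ ℝ³` be `δ₀`-separated
with finitely many centred `(r+2)`-patches, `W` `δ₀`-separated, and `V n` a sequence of sets that
is `1/(n+1)`-matched to `W` on the ball of radius `R'` and whose points of norm `≤ R + 2` carry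
`1/(n+1)`-approximate `(r+1)`-charts from rigid images of `S`. Then every point of `W` of norm
`≤ R + 1` carries an EXACT `r`-chart (pigeonhole on patches, compactness of rigid motions,
closedness of `W`). [folklore] -/
theorem exact_charts_of_approx {S W : Set (EuclideanSpace ℝ (Fin 3))}
    {V : ℕ → Set (EuclideanSpace ℝ (Fin 3))} {δ₀ r R R' : ℝ} (hδ₀ : 0 < δ₀) (hr : 0 < r)
    (hRR' : R + r + 3 ≤ R') (hS : ∀ z ∈ S, ∀ z' ∈ S, z ≠ z' → δ₀ ≤ dist z z')
    (hFLC : Set.Finite {T : Set (EuclideanSpace ℝ (Fin 3)) | ∃ z ∈ S,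
      T = (fun s => s - z) '' S ∩ closedBall (0 : EuclideanSpace ℝ (Fin 3)) (r + 2)})
    (hW : ∀ p ∈ W, ∀ q ∈ W, p ≠ q → δ₀ ≤ dist p q)
    (hBM : ∀ n : ℕ, BallMatch (1 / ((n : ℝ) + 1)) R' 0 (V n) W)
    (hch : ∀ n : ℕ, ∀ q ∈ V n, ‖q‖ ≤ R + 2 →
      ∃ g : EuclideanSpace ℝ (Fin 3) ≃ᵃⁱ[ℝ] EuclideanSpace ℝ (Fin 3),
        (∀ q' ∈ V n, dist q q' ≤ r + 1 → ∃ z ∈ S, dist q' (g z) ≤ 1 / ((n : ℝ) + 1)) ∧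
        (∀ z ∈ S, dist q (g z) ≤ r + 1 → ∃ q' ∈ V n, dist q' (g z) ≤ 1 / ((n : ℝ) + 1)))
    {w : EuclideanSpace ℝ (Fin 3)} (hw : w ∈ W) (hwR : ‖w‖ ≤ R + 1) :
    ∃ g : EuclideanSpace ℝ (Fin 3) ≃ᵃⁱ[ℝ] EuclideanSpace ℝ (Fin 3),
      (∀ w' ∈ W, dist w w' ≤ r → w' ∈ g '' S) ∧ (∀ z ∈ S, dist w (g z) ≤ r → g z ∈ W) := by
  have hθ1 : ∀ n : ℕ, 1 / ((n : ℝ) + 1) ≤ 1 := fun n =>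
    (Nat.one_div_le_one_div (Nat.zero_le n)).trans (by simp)
  -- approximants `wn n ∈ V n` of `w`, their charts `g n` and base points `z n`
  have hwn : ∀ n : ℕ, ∃ q ∈ V n, dist q w ≤ 1 / ((n : ℝ) + 1) := fun n =>
    (hBM n).1 w hw (by rw [dist_zero_right]; linarith)
  choose wn hwnV hwnw using hwn
  have hwn_norm : ∀ n, ‖wn n‖ ≤ R + 2 := fun n => by
    linarith [norm_le_dist_add_norm (wn n) w, hwnw n, hθ1 n]
  choose g hg1 hg2 using fun n => hch n (wn n) (hwnV n) (hwn_norm n)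
  choose z hzS hz using fun n => hg1 n (wn n) (hwnV n) (by rw [dist_self]; positivity)
  -- re-based motions `hmo n = g n ∘ (· + z n)`
  obtain ⟨hmo, hmo_apply⟩ : ∃ hmo : ℕ → EuclideanSpace ℝ (Fin 3) ≃ᵃⁱ[ℝ] EuclideanSpace ℝ (Fin 3),
      ∀ n s, hmo n s = g n (s + z n) :=
    ⟨fun n => (AffineIsometryEquiv.vaddConst ℝ (z n)).trans (g n), fun n s => by
      simp [vadd_eq_add]⟩
  have hmo0 : ∀ n, ‖hmo n 0‖ ≤ R + 3 := fun n => by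
    rw [hmo_apply, zero_add]
    have := norm_le_dist_add_norm (g n (z n)) (wn n)
    rw [dist_comm] at this
    linarith [hz n, hθ1 n, hwn_norm n]
  -- pigeonhole on the centred patches, then compactness of rigid motions
  obtain ⟨T, -, hTfreq⟩ := exists_frequently_eq hFLC
    (u := fun n => (fun s => s - z n) '' S ∩ closedBall 0 (r + 2)) fun n => ⟨z n, hzS n, rfl⟩
  obtain ⟨ψ₁, hψ₁, hψ₁T⟩ := extraction_of_frequently_atTop hTfreq
  obtain ⟨G, ψ₂, hψ₂, hG⟩ :=
    exists_subseq_tendsto_affineIsometryEquiv (fun k => hmo (ψ₁ k)) fun k => hmo0 (ψ₁ k)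
  set χ : ℕ → ℕ := fun k => ψ₁ (ψ₂ k) with hχ_def
  have hχ : StrictMono χ := hψ₁.comp hψ₂
  have hGlim : ∀ x, Tendsto (fun k => hmo (χ k) x) atTop (𝓝 (G x)) := hG
  have hTmem : ∀ k s, s ∈ T ↔ s + z (χ k) ∈ S ∧ ‖s‖ ≤ r + 2 := fun k s => by
    rw [← hψ₁T (ψ₂ k)]
    show s ∈ (fun s => s - z (χ k)) '' S ∩ closedBall 0 (r + 2) ↔ _
    simp only [mem_inter_iff, mem_image, mem_closedBall, dist_zero_right]
    constructor
    · rintro ⟨⟨x, hx, rfl⟩, h⟩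
      exact ⟨by simpa using hx, h⟩
    · rintro ⟨h1, h2⟩
      exact ⟨⟨s + z (χ k), h1, add_sub_cancel_right _ _⟩, h2⟩
  have hTfin : T.Finite := by
    refine finite_of_forall_le_dist_of_subset_closedBall hδ₀ (fun s hs s' hs' hss' => ?_)
      (c := 0) (R := r + 2) fun s hs => mem_closedBall_zero_iff.2 ((hTmem 0 s).1 hs).2
    have := hS _ ((hTmem 0 s).1 hs).1 _ ((hTmem 0 s').1 hs').1 fun h => hss' (add_right_cancel h)
    simpa using this
  -- limits along `χ`
  have hθχ : Tendsto (fun k => 1 / ((χ k : ℝ) + 1)) atTop (𝓝 0) :=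
    tendsto_one_div_add_atTop_nhds_zero_nat.comp hχ.tendsto_atTop
  have h2θχ : Tendsto (fun k => 1 / ((χ k : ℝ) + 1) + 1 / ((χ k : ℝ) + 1)) atTop (𝓝 0) := by
    simpa using hθχ.add hθχ
  have hwlim : Tendsto (fun k => wn (χ k)) atTop (𝓝 w) :=
    tendsto_iff_dist_tendsto_zero.2
      (squeeze_zero (fun _ => dist_nonneg) (fun k => hwnw (χ k)) hθχ)
  have h0lim : Tendsto (fun k => hmo (χ k) 0) atTop (𝓝 w) := by
    refine tendsto_iff_dist_tendsto_zero.2 (squeeze_zero (fun _ => dist_nonneg) (fun k => ?_) h2θχ)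
    calc dist (hmo (χ k) 0) w ≤ dist (hmo (χ k) 0) (wn (χ k)) + dist (wn (χ k)) w :=
          dist_triangle _ _ _
      _ ≤ 1 / ((χ k : ℝ) + 1) + 1 / ((χ k : ℝ) + 1) :=
          add_le_add (by rw [hmo_apply, zero_add, dist_comm]; exact hz _) (hwnw _)
  have hG0 : G 0 = w := tendsto_nhds_unique (hGlim 0) h0lim
  -- the exact chart: `x ↦ G (x - κ)` with `κ = z (χ 0)`
  set κ := z (χ 0) with hκ
  obtain ⟨gs, gs_apply⟩ : ∃ gs : EuclideanSpace ℝ (Fin 3) ≃ᵃⁱ[ℝ] EuclideanSpace ℝ (Fin 3),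
      ∀ x, gs x = G (x - κ) :=
    ⟨(AffineIsometryEquiv.vaddConst ℝ κ).symm.trans G, fun x => by simp [vsub_eq_sub]⟩
  have hGnorm : ∀ s, ‖G s‖ ≤ ‖s‖ + (R + 1) := fun s => by
    have := norm_le_dist_add_norm (G s) (G 0)
    rw [G.dist_map, dist_zero_right, hG0] at this
    linarith
  refine ⟨gs, fun w' hw' hww' => ?_, fun x hxS hx => ?_⟩
  · -- points of `W` near `w` are charted
    by_contra hnot
    have hnot' : w' ∉ G '' T := fun ⟨t, ht, htw'⟩ =>
      hnot ⟨t + κ, ((hTmem 0 t).1 ht).1, by rw [gs_apply, add_sub_cancel_right, htw']⟩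
    obtain ⟨η, hη, hfar⟩ := exists_pos_forall_le_dist (hTfin.image G) hnot'
    have h1 : ∀ᶠ k in atTop, ∀ t ∈ T, dist (hmo (χ k) t) (G t) < η / 3 :=
      (eventually_all_finite hTfin).2 fun t _ => Metric.tendsto_nhds.1 (hGlim t) _ (by positivity)
    have h2 : ∀ᶠ k in atTop, 1 / ((χ k : ℝ) + 1) < min (η / 3) (1 / 2) :=
      hθχ.eventually (eventually_lt_nhds (by positivity))
    obtain ⟨k, hk1, hk2⟩ := (h1.and h2).exists
    have hk2a : 1 / ((χ k : ℝ) + 1) < η / 3 := hk2.trans_le (min_le_left _ _)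
    have hk2b : 1 / ((χ k : ℝ) + 1) < 1 / 2 := hk2.trans_le (min_le_right _ _)
    obtain ⟨q, hqV, hqw'⟩ := (hBM (χ k)).1 w' hw' (by
      rw [dist_zero_right]; linarith [norm_le_dist_add_norm w' w, dist_comm w w'])
    have hdist : dist (wn (χ k)) q ≤ r + 1 := by
      calc dist (wn (χ k)) q ≤ dist (wn (χ k)) w + (dist w w' + dist q w') := by
            linarith [dist_triangle (wn (χ k)) w q, dist_triangle_right w q w']
        _ ≤ r + 1 := by linarith [hwnw (χ k)]
    obtain ⟨x, hxS, hxq⟩ := hg1 (χ k) q hqV hdist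
    set s := x - z (χ k) with hs_def
    have hs : hmo (χ k) s = g (χ k) x := by rw [hmo_apply, hs_def, sub_add_cancel]
    have hsT : s ∈ T := by
      refine (hTmem k s).2 ⟨by rwa [hs_def, sub_add_cancel], ?_⟩
      have h0 : ‖s‖ = dist (hmo (χ k) s) (hmo (χ k) 0) := by
        rw [(hmo (χ k)).dist_map, dist_zero_right]
      rw [h0, hs, hmo_apply, zero_add]
      calc dist (g (χ k) x) (g (χ k) (z (χ k)))
          ≤ dist q (g (χ k) x) + (dist (wn (χ k)) q + dist (wn (χ k)) (g (χ k) (z (χ k)))) := by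
            linarith [dist_triangle_left (g (χ k) x) (g (χ k) (z (χ k))) (wn (χ k)),
              dist_triangle_left (wn (χ k)) (g (χ k) x) q, dist_comm (wn (χ k)) (g (χ k) x),
              dist_comm q (wn (χ k))]
        _ ≤ r + 2 := by linarith [hz (χ k), hθ1 (χ k)]
    have hfar' := hfar (G s) (mem_image_of_mem G hsT)
    have hk1s : dist (hmo (χ k) s) (G s) < η / 3 := hk1 s hsT
    rw [hs] at hk1s
    have hclose : dist (G s) w' < η := by
      calc dist (G s) w' ≤ dist (g (χ k) x) (G s) + (dist q (g (χ k) x) + dist q w') := by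
            linarith [dist_triangle (G s) (g (χ k) x) w', dist_triangle_left (g (χ k) x) w' q,
              dist_comm (G s) (g (χ k) x)]
        _ < η / 3 + (η / 3 + η / 3) :=
            add_lt_add hk1s (add_lt_add (hxq.trans_lt hk2a) (hqw'.trans_lt hk2a))
        _ = η := by ring
    linarith
  · -- images of `S` near `w` are points of `W`
    set s := x - κ with hs_def
    have hgx : gs x = G s := gs_apply x
    have hsS : s + κ ∈ S := by rwa [hs_def, sub_add_cancel]
    have hsnorm : ‖s‖ ≤ r := by
      have h0 : ‖s‖ = dist (G s) (G 0) := by rw [G.dist_map, dist_zero_right]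
      rw [h0, hG0, ← hgx, dist_comm]
      exact hx
    have hsT : s ∈ T := (hTmem 0 s).2 ⟨hsS, by linarith⟩
    rw [hgx]
    refine mem_of_forall_exists_dist_lt hδ₀ hW fun η hη => ?_
    have h1 : ∀ᶠ k in atTop, dist (hmo (χ k) s) (G s) < min (η / 3) 1 :=
      Metric.tendsto_nhds.1 (hGlim s) _ (by positivity)
    have h2 : ∀ᶠ k in atTop, 1 / ((χ k : ℝ) + 1) < min (η / 3) 1 :=
      hθχ.eventually (eventually_lt_nhds (by positivity))
    have h3 : ∀ᶠ k in atTop, dist (wn (χ k)) (hmo (χ k) s) < r + 1 :=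
      (hwlim.dist (hGlim s)).eventually
        (eventually_lt_nhds (show dist w (G s) < r + 1 by rw [← hgx]; linarith))
    obtain ⟨k, hk1, hk2, hk3⟩ := (h1.and (h2.and h3)).exists
    have hk1a : dist (hmo (χ k) s) (G s) < η / 3 := hk1.trans_le (min_le_left _ _)
    have hk1b : dist (hmo (χ k) s) (G s) < 1 := hk1.trans_le (min_le_right _ _)
    have hk2a : 1 / ((χ k : ℝ) + 1) < η / 3 := hk2.trans_le (min_le_left _ _)
    have hk2b : 1 / ((χ k : ℝ) + 1) < 1 := hk2.trans_le (min_le_right _ _)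
    have hsk : s + z (χ k) ∈ S := ((hTmem k s).1 hsT).1
    obtain ⟨q, hqV, hq⟩ := hg2 (χ k) (s + z (χ k)) hsk (by rw [← hmo_apply]; exact hk3.le)
    rw [← hmo_apply] at hq
    have hqnorm : dist q 0 ≤ R' := by
      rw [dist_zero_right]
      linarith [norm_le_dist_add_norm q (hmo (χ k) s), norm_le_dist_add_norm (hmo (χ k) s) (G s),
        hGnorm s]
    obtain ⟨p, hpW, hqp⟩ := (hBM (χ k)).2 q hqV hqnorm
    refine ⟨p, hpW, ?_⟩
    calc dist p (G s) ≤ dist q p + (dist q (hmo (χ k) s) + dist (hmo (χ k) s) (G s)) := by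
          linarith [dist_triangle_left p (G s) q, dist_triangle q (hmo (χ k) s) (G s)]
      _ < η / 3 + (η / 3 + η / 3) :=
          add_lt_add (hqp.trans_lt hk2a) (add_lt_add (hq.trans_lt hk2a) hk1a)
      _ = η := by ring

/-! ## The theorem -/

/-- **Kinematic compactness: approximate local charts integrate approximately.** Let `S ⊆ ℝ³`
be `δ₀`-uniformly discrete with finite local complexity and suppose EXACT local `r`-charts of
`δ₀`-separated windows `W ⊆ B̄(0, R')` (`0 ∈ W`) from rigid images of `S` integrate to an exact
global `R`-chart at `0`. Then for every `ε > 0` there is `θ > 0` such that `θ`-approximate local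
`(r+1)`-charts integrate to an `ε`-approximate global `R`-chart. Proof by contradiction: bad
windows `W_n` with `θ = 1/(n+1)` have a local-matching limit `W`
(`exists_subseq_forall_eventually_ballMatch`), which is exactly charted
(`exact_charts_of_approx`), hence globally charted by hypothesis; by discreteness of `W` the
global chart is an `ε`-chart of `W_n` for `n` large. [folklore] -/
theorem stub_kinematicCompactness : ∀ (S : Set (EuclideanSpace ℝ (Fin 3))) (δ₀ r R R' : ℝ), 0 < δ₀ → 0 < r → 0 < R → R + r + 3 ≤ R' → (∀ z ∈ S, ∀ z' ∈ S, z ≠ z' → δ₀ ≤ dist z z') → (∀ ρ : ℝ, Set.Finite {T : Set (EuclideanSpace ℝ (Fin 3)) | ∃ z ∈ S, T = (fun s => s - z) '' S ∩ Metric.closedBall (0 : EuclideanSpace ℝ (Fin 3)) ρ}) → (∀ W : Set (EuclideanSpace ℝ (Fin 3)), W ⊆ Metric.closedBall (0 : EuclideanSpace ℝ (Fin 3)) R' → (0 : EuclideanSpace ℝ (Fin 3)) ∈ W → (∀ w ∈ W, ∀ w' ∈ W, w ≠ w' → δ₀ ≤ dist w w') → (∀ w ∈ W, ‖w‖ ≤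 R + 1 → ∃ g : EuclideanSpace ℝ (Fin 3) ≃ᵃⁱ[ℝ] EuclideanSpace ℝ (Fin 3), (∀ w' ∈ W, dist w w' ≤ r → w' ∈ g '' S) ∧ (∀ z ∈ S, dist w (g z) ≤ r → g z ∈ W)) → ∃ g : EuclideanSpace ℝ (Fin 3) ≃ᵃⁱ[ℝ] EuclideanSpace ℝ (Fin 3), (∀ w' ∈ W, dist (0 : EuclideanSpace ℝ (Fin 3)) w' ≤ R → w' ∈ g '' S) ∧ (∀ z ∈ S, dist (0 : EuclideanSpace ℝ (Fin 3)) (g z) ≤ R → g z ∈ W)) → ∀ ε : ℝ, 0 < ε → ∃ θ : ℝ, 0 < θ ∧ ∀ W : Set (EuclideanSpace ℝ (Fin 3)), W ⊆ Metric.closedBall (0 : EuclideanSpace ℝ (Fin 3)) R' → (0 : EuclideanSpace ℝ (Fin 3)) ∈ W → (∀ w ∈ W, ∀ w' ∈ W, w ≠ w' → δ₀ ≤ dist w w') → (∀ w ∈ W, ‖w‖ ≤ R + 2 → ∃ g : EuclideanSpace ℝ (Fin 3) ≃ᵃⁱ[ℝ] EuclideanSpace ℝ (Fin 3), (∀ w'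 ∈ W, dist w w' ≤ (r + 1) → ∃ z ∈ S, dist w' (g z) ≤ θ) ∧ (∀ z ∈ S, dist w (g z) ≤ (r + 1) → ∃ w' ∈ W, dist w' (g z) ≤ θ)) → ∃ g : EuclideanSpace ℝ (Fin 3) ≃ᵃⁱ[ℝ] EuclideanSpace ℝ (Fin 3), (∀ w' ∈ W, dist (0 : EuclideanSpace ℝ (Fin 3)) w' ≤ R → ∃ z ∈ S, dist w' (g z) ≤ ε) ∧ (∀ z ∈ S, dist (0 : EuclideanSpace ℝ (Fin 3)) (g z) ≤ R → ∃ w' ∈ W, dist w' (g z) ≤ ε) := by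
  intro S δ₀ r R R' hδ₀ hr _hR hRR' hS hFLC hExact ε hε
  by_contra hcon
  -- bad windows at every tolerance `1 / (n + 1)`
  have hbad : ∀ n : ℕ, ∃ W : Set (EuclideanSpace ℝ (Fin 3)),
      W ⊆ closedBall (0 : EuclideanSpace ℝ (Fin 3)) R' ∧ (0 : EuclideanSpace ℝ (Fin 3)) ∈ W ∧
      (∀ w ∈ W, ∀ w' ∈ W, w ≠ w' → δ₀ ≤ dist w w') ∧
      (∀ w ∈ W, ‖w‖ ≤ R + 2 → ∃ g : EuclideanSpace ℝ (Fin 3) ≃ᵃⁱ[ℝ] EuclideanSpace ℝ (Fin 3),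
        (∀ w' ∈ W, dist w w' ≤ r + 1 → ∃ z ∈ S, dist w' (g z) ≤ 1 / ((n : ℝ) + 1)) ∧
        (∀ z ∈ S, dist w (g z) ≤ r + 1 → ∃ w' ∈ W, dist w' (g z) ≤ 1 / ((n : ℝ) + 1))) ∧
      ¬ ∃ g : EuclideanSpace ℝ (Fin 3) ≃ᵃⁱ[ℝ] EuclideanSpace ℝ (Fin 3),
        (∀ w' ∈ W, dist (0 : EuclideanSpace ℝ (Fin 3)) w' ≤ R → ∃ z ∈ S, dist w' (g z) ≤ ε) ∧
        (∀ z ∈ S, dist (0 : EuclideanSpace ℝ (Fin 3)) (g z) ≤ R → ∃ w' ∈ W, dist w' (g z) ≤ ε) := by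
    intro n
    by_contra h
    push Not at h
    exact hcon ⟨1 / ((n : ℝ) + 1), Nat.one_div_pos_of_nat, h⟩
  choose V hVR' hV0 hVsep hVch hVbad using hbad
  -- local-matching limit `W` along a subsequence `φ`
  obtain ⟨φ, W, hφ, hWsep, hBMev⟩ := exists_subseq_forall_eventually_ballMatch hδ₀ V hVsep
  have hWR' : W ⊆ closedBall (0 : EuclideanSpace ℝ (Fin 3)) R' := by
    intro p hp
    rw [mem_closedBall_zero_iff]
    refine le_of_forall_pos_le_add fun η hη => ?_
    obtain ⟨k, hk⟩ := (hBMev ‖p‖ η hη).exists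
    obtain ⟨q, hq, hqp⟩ := hk.1 p hp (by rw [dist_zero_right])
    have hqR' := mem_closedBall_zero_iff.1 (hVR' (φ k) hq)
    linarith [norm_le_dist_add_norm p q, dist_comm p q]
  have hW0 : (0 : EuclideanSpace ℝ (Fin 3)) ∈ W := by
    refine mem_of_forall_exists_dist_lt hδ₀ hWsep fun η hη => ?_
    obtain ⟨k, hk⟩ := (hBMev 0 (η / 2) (half_pos hη)).exists
    obtain ⟨p, hp, h0p⟩ := hk.2 0 (hV0 (φ k)) (by rw [dist_self])
    exact ⟨p, hp, by rw [dist_comm]; linarith⟩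
  -- a further subsequence `ψ` along which the matching tolerance is `1 / (n + 1)`
  obtain ⟨ψ, hψ, hBM⟩ := extraction_forall_of_eventually
    (P := fun n k => BallMatch (1 / ((n : ℝ) + 1)) R' 0 (V (φ k)) W) fun n =>
      hBMev R' _ Nat.one_div_pos_of_nat
  have hch : ∀ n : ℕ, ∀ q ∈ V (φ (ψ n)), ‖q‖ ≤ R + 2 →
      ∃ g : EuclideanSpace ℝ (Fin 3) ≃ᵃⁱ[ℝ] EuclideanSpace ℝ (Fin 3),
        (∀ q' ∈ V (φ (ψ n)), dist q q' ≤ r + 1 → ∃ z ∈ S, dist q' (g z) ≤ 1 / ((n : ℝ) + 1)) ∧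
        (∀ z ∈ S, dist q (g z) ≤ r + 1 →
          ∃ q' ∈ V (φ (ψ n)), dist q' (g z) ≤ 1 / ((n : ℝ) + 1)) := by
    intro n q hq hqR
    obtain ⟨g, h1, h2⟩ := hVch (φ (ψ n)) q hq hqR
    have hle : 1 / ((φ (ψ n) : ℝ) + 1) ≤ 1 / ((n : ℝ) + 1) :=
      Nat.one_div_le_one_div (hφ.comp hψ).le_apply
    exact ⟨g, fun q' hq' hd => let ⟨z, hz, hd'⟩ := h1 q' hq' hd; ⟨z, hz, hd'.trans hle⟩,
      fun z hz hd => let ⟨q', hq', hd'⟩ := h2 z hz hd; ⟨q', hq', hd'.trans hle⟩⟩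
  -- `W` is exactly charted, hence globally charted
  obtain ⟨g, hg1, hg2⟩ := hExact W hWR' hW0 hWsep fun w hw hwR =>
    exact_charts_of_approx hδ₀ hr hRR' hS (hFLC (r + 2)) hWsep hBM hch hw hwR
  -- discreteness of `W`: no point of `W` has norm in `(R, R + η₀]`
  obtain ⟨η₀, hη₀, hgap⟩ : ∃ η₀ : ℝ, 0 < η₀ ∧ ∀ p ∈ W, ‖p‖ ≤ R + η₀ → ‖p‖ ≤ R := by
    have hfin : ((fun p : EuclideanSpace ℝ (Fin 3) => ‖p‖) ''
        (W ∩ closedBall (0 : EuclideanSpace ℝ (Fin 3)) (R + 1)) ∩ Ioi R).Finite :=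
      ((finite_of_forall_le_dist_of_subset_closedBall hδ₀
        (fun a ha b hb hab => hWsep a ha.1 b hb.1 hab) inter_subset_right).image _).inter_of_left _
    obtain ⟨η, hη, hfar⟩ := exists_pos_forall_le_dist hfin (p := R) fun h => lt_irrefl R h.2
    refine ⟨min (η / 2) 1, by positivity, fun p hp hpR => not_lt.1 fun hlt => ?_⟩
    have hmem : ‖p‖ ∈ (fun p : EuclideanSpace ℝ (Fin 3) => ‖p‖) ''
        (W ∩ closedBall (0 : EuclideanSpace ℝ (Fin 3)) (R + 1)) ∩ Ioi R :=
      ⟨⟨p, ⟨hp, mem_closedBall_zero_iff.2 (hpR.trans (by linarith [min_le_right (η / 2) 1]))⟩,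
        rfl⟩, hlt⟩
    have h1 := hfar _ hmem
    rw [Real.dist_eq, abs_of_pos (sub_pos.2 hlt)] at h1
    linarith [min_le_left (η / 2) 1]
  -- contradiction at a large index
  obtain ⟨n, hn⟩ : ∃ n : ℕ, 1 / ((n : ℝ) + 1) < min ε η₀ :=
    (tendsto_one_div_add_atTop_nhds_zero_nat.eventually
      (eventually_lt_nhds (lt_min hε hη₀))).exists
  have hnε : 1 / ((n : ℝ) + 1) ≤ ε := (hn.trans_le (min_le_left _ _)).le
  have hnη : 1 / ((n : ℝ) + 1) ≤ η₀ := (hn.trans_le (min_le_right _ _)).le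
  refine hVbad (φ (ψ n)) ⟨g, fun w' hw' hw'R => ?_, fun x hxS hxR => ?_⟩
  · rw [dist_comm, dist_zero_right] at hw'R
    obtain ⟨p, hpW, hw'p⟩ := (hBM n).2 w' hw' (by rw [dist_zero_right]; linarith)
    have hpR : ‖p‖ ≤ R := hgap p hpW (by linarith [norm_le_dist_add_norm p w', dist_comm p w'])
    obtain ⟨x, hxS, hx⟩ := hg1 p hpW (by rwa [dist_comm, dist_zero_right])
    exact ⟨x, hxS, by rw [hx]; exact hw'p.trans hnε⟩
  · have hgxW : g x ∈ W := hg2 x hxS hxR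
    rw [dist_comm, dist_zero_right] at hxR
    obtain ⟨q, hqV, hq⟩ := (hBM n).1 (g x) hgxW (by rw [dist_zero_right]; linarith)
    exact ⟨q, hqV, hq.trans hnε⟩

end Summit.AtomisticToContinuum.Crystallization.Theorems.PricedHcpWindowsKinematicCompactness
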